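import Literature.NumberTheory.EllipticCurves.Isogeny
import Literature.NumberTheory.EllipticCurves.NewformGaloisRep
import Literature.NumberTheory.EllipticCurves.CuspFormLFunction
import Literature.NumberTheory.EllipticCurves.GlobalMinimalModelProofs
import Literature.NumberTheory.EllipticCurves.IsogenyVariableChangeProofs
import Literature.NumberTheory.EllipticCurves.IsogenyCompProofs
import Literature.NumberTheory.EllipticCurves.LFunctionPrimeCoeff
import Literature.NumberTheory.EllipticCurves.LFunctionSmulProofs
import Literature.NumberTheory.EllipticCurves.ModularityVersionApProofs
import HarnessLib

/-!
# Faltings' isogeny theorem over `ℚ` in terms of `a_p` at almost all primes (model-free form)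

The tree vendors Faltings' isogeny theorem for elliptic curves over `ℚ` (Faltings 1983, §5,
Korollar 2 zu Satz 4: abelian varieties over a number field are isogenous iff their local
`L`-factors agree at almost all places) as the named fact
`WeierstrassCurve.isIsogenous_iff_frobeniusTrace_eq` (`Isogeny.lean`): two *globally minimal*
models `W`, `W'` of elliptic curves over `ℚ` are `ℚ`-isogenous iff
`frobeniusTrace W p = frobeniusTrace W' p` for all but finitely many primes `p`
(`frobeniusTrace W p = p + 1 − #W̃(𝔽_p)`, defined for globally minimal models only).
`EichlerShimuraConstruction.lean` derives from it the form "`W.LFunction = W'.LFunction` ⟹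
`W ~ W'`" for arbitrary models (`WeierstrassCurve.isIsogenous_of_LFunction_eq`).

This file proves the intermediate, literally printed form (iii) ⇒ (i) of Faltings' corollary for
arbitrary models and Mathlib's model-independent `WeierstrassCurve.LFunction`:

* `WeierstrassCurve.isIsogenous_of_finite_setOf_LFunction_ne` — if `a_p(W) = a_p(W')` for all
  but finitely many primes `p` (`a_p` the `p`-th coefficient of `WeierstrassCurve.LFunction`),
  then `W ~ W'` over `ℚ`. Proof: pass to global minimal models `C • W`, `C' • W'`
  (`hasGlobalMinimalModel_rat_holds`), which are isogenous to the given curves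
  (`isIsogenous_smul`, `isIsogenous_of_smul`, `IsIsogenous.trans'`), have the same
  `L`-functions (`LFunction_smul`), and satisfy `a_p = frobeniusTrace p` at every prime of good
  reduction (`LFunction_apply_prime_eq_frobeniusTrace`), i.e. at every prime not dividing the
  conductor (`dvd_conductorNorm_iff_not_hasGoodReductionAtPrime`; the conductor is positive,
  `conductorNorm_pos_holds`); so the Frobenius traces of the minimal models differ at finitely
  many primes only and the named fact applies;
* `Literature.NumberTheory.EllipticCurves.ModularForms.IsNewformOf.isIsogenous_of_cuspCoeff_prime_eq` — consequently, if `f` is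
  the newform of `W` (`IsNewformOf W f`, level `N`) and `W₀/ℚ` is any elliptic curve with
  `a_p(f) = a_p(W₀)` for the primes `p ∤ N` — the conclusion of the tree's Eichler–Shimura fact
  `exists_weierstrassCurve_of_rational_isNewform0` (`NewformGaloisRep.lean`, Shimura 1971,
  Thm. 7.14 with 7.24) — then `W₀ ~ W`; and
  `Literature.NumberTheory.EllipticCurves.ModularForms.IsNewformOf.exists_isIsogenous_of_eichlerShimura` — from that weaker
  Eichler–Shimura fact and Faltings' theorem, every elliptic curve over `ℚ` having a newform is
  `ℚ`-isogenous to an Eichler–Shimura curve of its newform ("a construction of Shimura and a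
  theorem of Faltings", Breuil–Conrad–Diamond–Taylor 2001, p. 845, (2) ⇒ (6), isogeny part).

## References

* G. Faltings, *Endlichkeitssätze für abelsche Varietäten über Zahlkörpern*, Invent. Math. 73
  (1983), 349–366: §5, Korollar 2 zu Satz 4.
* C. Breuil, B. Conrad, F. Diamond, R. Taylor, *On the modularity of elliptic curves over `ℚ`:
  wild 3-adic exercises*, J. Amer. Math. Soc. 14 (2001), 843–939: p. 845, (2) ⇒ (6).
* G. Shimura, *Introduction to the arithmetic theory of automorphic functions*, 1971: Thm. 7.14,
  Thm. 7.15.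
-/

noncomputable section

open scoped MatrixGroups ModularForm

open CongruenceSubgroup

/-! ### Faltings' corollary, (iii) ⇒ (i), for Mathlib's `LFunction` -/

namespace WeierstrassCurve

/-- **Faltings' isogeny theorem over `ℚ`, `a_p` at almost all primes, arbitrary models**: if
two elliptic curves over `ℚ` (any Weierstrass models `W`, `W'`) have `a_p(W) = a_p(W')` for all
but finitely many primes `p` — `a_p` the `p`-th coefficient of Mathlib's
`WeierstrassCurve.LFunction`, computed on local minimal models and hence model-independent —
then they are isogenous over `ℚ` (Faltings 1983, §5, Korollar 2 zu Satz 4, (iii) ⇒ (i):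
"`L_v(A₁, s) = L_v(A₂, s)` for almost all `v`" implies "`A₁` is isogenous to `A₂`"; at a prime of
good reduction the local factor `(1 − a_p p⁻ˢ + p^{1−2s})⁻¹` is determined by `a_p`). Proved from
the tree's named fact `isIsogenous_iff_frobeniusTrace_eq` (the same theorem for globally minimal
models, via `frobeniusTrace`), taken as the hypothesis `hF`; see the module docstring for the
route. The tree's `isIsogenous_of_LFunction_eq` (`EichlerShimuraConstruction.lean`) is the case
of an empty exceptional set. (Dot-notation extension of the Mathlib namespace
`WeierstrassCurve`.) [cite: Faltings1983Endlichkeit, §5 Korollar 2] -/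
theorem isIsogenous_of_finite_setOf_LFunction_ne (hF : isIsogenous_iff_frobeniusTrace_eq)
    (W W' : WeierstrassCurve ℚ) [W.IsElliptic] [W'.IsElliptic]
    (h : {p : ℕ | p.Prime ∧ W.LFunction p ≠ W'.LFunction p}.Finite) : IsIsogenous W W' := by
  obtain ⟨C, hC⟩ := hasGlobalMinimalModel_rat_holds W
  obtain ⟨C', hC'⟩ := hasGlobalMinimalModel_rat_holds W'
  -- the primes of bad reduction of either curve divide the product of the conductors
  set n : ℕ := (C • W).conductorNorm ℤ * (C' • W').conductorNorm ℤ with hn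
  have hn0 : n ≠ 0 :=
    mul_ne_zero (conductorNorm_pos_holds (C • W)).ne' (conductorNorm_pos_holds (C' • W')).ne'
  have hbad : {p : ℕ | p.Prime ∧ p ∣ n}.Finite :=
    n.primeFactors.finite_toSet.subset fun p hp ↦
      (Nat.mem_primeFactors_of_ne_zero hn0).mpr hp
  have hmin :
      {p : ℕ | p.Prime ∧ (C • W).frobeniusTrace p ≠ (C' • W').frobeniusTrace p}.Finite := by
    refine (h.union hbad).subset ?_
    rintro p ⟨hp, hne⟩
    by_contra hnot
    simp only [Set.mem_union, Set.mem_setOf_eq, not_or, not_and, not_not] at hnot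
    haveI : Fact p.Prime := ⟨hp⟩
    have hgood : (C • W).HasGoodReductionAtPrime p := by
      by_contra hb
      exact hnot.2 hp (dvd_mul_of_dvd_left
        (((C • W).dvd_conductorNorm_iff_not_hasGoodReductionAtPrime p).mpr hb) _)
    have hgood' : (C' • W').HasGoodReductionAtPrime p := by
      by_contra hb
      exact hnot.2 hp (dvd_mul_of_dvd_right
        (((C' • W').dvd_conductorNorm_iff_not_hasGoodReductionAtPrime p).mpr hb) _)
    apply hne
    rw [← LFunction_apply_prime_eq_frobeniusTrace _ p hgood,
      ← LFunction_apply_prime_eq_frobeniusTrace _ p hgood', LFunction_smul, LFunction_smul]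
    exact hnot.1 hp
  have hiso : IsIsogenous (C • W) (C' • W') := (hF (C • W) (C' • W')).mpr hmin
  exact ((isIsogenous_smul W C).trans' hiso).trans' (isIsogenous_of_smul W' C')

end WeierstrassCurve

/-! ### Curves with the newform `f` are isogenous to the Eichler–Shimura curves of `f` -/

namespace Literature.NumberTheory.EllipticCurves.ModularForms

variable {N : ℕ} [NeZero N]

/-- **A curve matching `a_p(f)` at the primes `p ∤ N` is isogenous to every curve with newform
`f`.** If `f ∈ S₂(Γ₀(N))` is the newform of the elliptic curve `W/ℚ` (`IsNewformOf W f`: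
`aₙ(f) = aₙ(W)` for all `n`) and `W₀/ℚ` is an elliptic curve with `a_p(f) = a_p(W₀)` for every
prime `p ∤ N` (the conclusion of `exists_weierstrassCurve_of_rational_isNewform0`), then
`a_p(W₀) = a_p(W)` off the finitely many prime divisors of `N`, so `W₀ ~ W` over `ℚ` by
Faltings' theorem (`WeierstrassCurve.isIsogenous_of_finite_setOf_LFunction_ne`, conditional on
the tree's `isIsogenous_iff_frobeniusTrace_eq`). [cite: Faltings1983Endlichkeit, §5 Korollar 2] -/
theorem IsNewformOf.isIsogenous_of_cuspCoeff_prime_eq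
    (hF : WeierstrassCurve.isIsogenous_iff_frobeniusTrace_eq) {W W₀ : WeierstrassCurve ℚ}
    [W.IsElliptic] [W₀.IsElliptic] {f : CuspForm (Gamma0 N) 2} (hf : IsNewformOf W f)
    (h₀ : ∀ p : ℕ, p.Prime → ¬ p ∣ N → cuspCoeff f p = (W₀.LFunction p : ℂ)) :
    W₀.IsIsogenous W := by
  refine WeierstrassCurve.isIsogenous_of_finite_setOf_LFunction_ne hF W₀ W ?_
  refine (N.primeFactors.finite_toSet.subset ?_)
  rintro p ⟨hp, hne⟩
  refine (Nat.mem_primeFactors_of_ne_zero (NeZero.ne N)).mpr ⟨hp, ?_⟩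
  by_contra hpN
  exact hne (by exact_mod_cast (h₀ p hp hpN).symm.trans (hf.2 p))

/-- If `f` is the newform of a Weierstrass curve `W/ℚ` then its coefficient field is `ℚ` (all
`aₙ(f) = aₙ(W)` are integers); the same statement as `IsNewformOf.coeffField_eq_bot` of
`PAdicLFunctionProofs.lean`, repeated here to avoid importing the `p`-adic files. [folklore] -/
theorem IsNewformOf.coeffField_eq_bot_of_isNewformOf {W : WeierstrassCurve ℚ}
    {f : CuspForm (Gamma0 N) 2} (hf : IsNewformOf W f) : coeffField f = ⊥ := by
  rw [coeffField, IntermediateField.adjoin_eq_bot_iff]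
  rintro _ ⟨n, rfl⟩
  rw [SetLike.mem_coe, IntermediateField.mem_bot]
  refine ⟨(W.LFunction n : ℚ), ?_⟩
  rw [map_intCast]
  exact (hf.2 n).symm

/-- **"A construction of Shimura and a theorem of Faltings", isogeny part** (Breuil–Conrad–
Diamond–Taylor 2001, p. 845, (2) ⇒ (6)), from facts already in the tree: if `f ∈ S₂(Γ₀(N))`
is the newform of the elliptic curve `W/ℚ`, then `W` is `ℚ`-isogenous to an Eichler–Shimura
curve `W₀` of `f` — a curve with `a_p(f) = a_p(W₀)` for all primes `p ∤ N`, as provided by the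
named fact `exists_weierstrassCurve_of_rational_isNewform0` (`NewformGaloisRep.lean`; Shimura
1971, Thm. 7.14 with Thm. 7.15; Knapp 1993, Thm. 11.74 (e)) applied to `f`, whose coefficient
field is `ℚ` (`IsNewformOf.coeffField_eq_bot_of_isNewformOf`) — by Faltings' isogeny theorem
(`IsNewformOf.isIsogenous_of_cuspCoeff_prime_eq`).
[cite: BCDTJAMS2001, p. 845, (2) ⇒ (6)] [cite: ShimuraIATAF1971, Thm. 7.14 and Thm. 7.15] -/
theorem IsNewformOf.exists_isIsogenous_of_eichlerShimura
    (hES : exists_weierstrassCurve_of_rational_isNewform0 (N := N))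
    (hF : WeierstrassCurve.isIsogenous_iff_frobeniusTrace_eq) {W : WeierstrassCurve ℚ}
    [W.IsElliptic] {f : CuspForm (Gamma0 N) 2} (hf : IsNewformOf W f) :
    ∃ W₀ : WeierstrassCurve ℚ, W₀.IsElliptic ∧
      (∀ p : ℕ, p.Prime → ¬ p ∣ N → cuspCoeff f p = (W₀.LFunction p : ℂ)) ∧
        W₀.IsIsogenous W := by
  obtain ⟨W₀, hW₀, h₀⟩ := hES f hf.1 hf.coeffField_eq_bot_of_isNewformOf
  haveI := hW₀
  exact ⟨W₀, hW₀, h₀, hf.isIsogenous_of_cuspCoeff_prime_eq hF h₀⟩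

end Literature.NumberTheory.EllipticCurves.ModularForms

end
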